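import Mathlib
import HarnessLib.Audit
import Summits.PneNP.PneNP.Theorems.PstarGateCaseTStructure
import Summits.PneNP.PneNP.Theorems.PstarGateForest
import Summits.PneNP.PneNP.Theorems.PstarGateSharedEdge
import Summits.PneNP.PneNP.Theorems.PstarNorUnitEQ1Tools

/-!
# One GATED chord, CASE T: a private edge of the gated cycle is READ beyond its own monomial — the touch lemma (E2 node N4X; prover-1 g20)

FRONTIER range-avoidance ladder, rung F-N3 (`stmt-PneNP-19007`), cell `pnp-ideate` (`PstarGateNodesX.GateCaseTQuadX`); restricted-model proof
complexity — nothing here bears on `P` versus `NP`.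

CASE T with at least one other chord.  Let `π ∈ D e` be a tree edge avoiding `u` that is PRIVATE within `J₀ ∪ {g₀}` (AND pair `α = vars π 2`,
`α' = vars π 3` read by no other output of the core nor by the gate).  Then `π` lies on every other fundamental set (`caseT_through`), so
flipping `x_α` changes EVERY prescribed product `u_c` by `x_{α'}` (and `x_{α'}` by `x_α`), while all read vectors are untouched (the other chords
have constant reads, the gated chord reads through `x_u` only).  Take the (M0) witness at `π` in defect form (`gate_forest_minimality`,
`defect_eq_one`): every chord's state product is `u_c + 1` and the value is `t + ([π ∈ T₁], [π ∈ T₂])`.  One of the three flips `e_α`, `e_{α'}`,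
`e_α + e_{α'}` raises every `u_c` by one, so the witness states become ADMISSIBLE at the flipped point; if the two constraints read `α, α'` only
through `π`'s own monomial (second differences `polarDir mv (e_α, e_{α'})`, `polarDir (1,0)(e_α, e_{α'})` and nothing else), the state-free part
moves by exactly `([π ∈ T₁], [π ∈ T₂])` and the value hits the target — contradicting infeasibility (T3).  Hence:

* `u_flip_fst` / `u_flip_snd` — the prescribed products under the private flips;
* `val_flip` — the value moves by the state-free part only;
* `caseT_private_touch` — **the two directional constraints `q_mv`, `q_{(1,0)}` do NOT both read `α, α'` through `π`'s monomial alone**: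
  `¬ ∀ y, (q_mv (y + e_α) = q_mv y + τ·y_{α'} ∧ q_mv (y + e_{α'}) = q_mv y + τ·y_α ∧ q_{(1,0)}(y + e_α) = q_{(1,0)} y + τ₂·y_{α'} ∧
  q_{(1,0)}(y + e_{α'}) = q_{(1,0)} y + τ₂·y_α)` with `τ = polarDir mv (e_α, e_{α'})`, `τ₂ = polarDir (1,0) (e_α, e_{α'})`.
-/

set_option linter.dupNamespace false -- `Summit.PneNP.PneNP.…`: summit = sub-problem name (D-0017 single-conjunct layout)

open Finset Module Literature.Computability.Complexity
open scoped symmDiff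
open Summit.PneNP.PneNP.Theorems.PstarFibrePolys (bit)
open Summit.PneNP.PneNP.Theorems.PstarTyped (Typed)
open Summit.PneNP.PneNP.Theorems.PstarSALevel (varSet bdry BoundaryExpanding SimpleOverlap)
open Summit.PneNP.PneNP.Theorems.PstarGapLinearised (andPair andPair_subset_varSet)
open Summit.PneNP.PneNP.Theorems.PstarChordEndgameTools (mem_andPair_iff)
open Summit.PneNP.PneNP.Theorems.PstarCentreFree (vars_mem_varSet)
open Summit.PneNP.PneNP.Theorems.PstarProductRank (qform polar)
open Summit.PneNP.PneNP.Theorems.PstarReadSumset (V2)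
open Summit.PneNP.PneNP.Theorems.PstarChordSystem (ChordSystem)
open Summit.PneNP.PneNP.Theorems.PstarChordBridgeTools (privs coef free vars_mem_privs)
open Summit.PneNP.PneNP.Theorems.PstarChordBridge (BridgeData sys sys_F sys_t Solution Lift infeasible_of_not_solution)
open Summit.PneNP.PneNP.Theorems.PstarChordBridgeForcing (gam sys_u_eq)
open Summit.PneNP.PneNP.Theorems.PstarChordBridgeBasis (qDir polarDir)
open Summit.PneNP.PneNP.Theorems.PstarChordBridgeForest (defect_eq_one)
open Summit.PneNP.PneNP.Theorems.PstarNorUnitEQ1Tools (polarDir_single_pair)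
open Summit.PneNP.PneNP.Theorems.PstarGateBridge (GateHyp const_of_others gate_reads)
open Summit.PneNP.PneNP.Theorems.PstarGateHyperplane (qform_single_and)
open Summit.PneNP.PneNP.Theorems.PstarGateCaseTLocal (u_add)
open Summit.PneNP.PneNP.Theorems.PstarGateForest (gate_forest_minimality)
open Summit.PneNP.PneNP.Theorems.PstarGateSharedEdge (polar_single_of_private)
open Summit.PneNP.PneNP.Theorems.PstarGateNodes (GateData)
open Summit.PneNP.PneNP.Theorems.PstarGateNodesX (GateDataX)
open Summit.PneNP.PneNP.Theorems.PstarGateCaseTStructure (caseT_through)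

namespace Summit.PneNP.PneNP.Theorems.PstarGateCaseTPrivateTouch

variable {n m : ℕ}

section CaseT

variable (I : LocalMap 4 n m) (hI : I.IsPure xorAndPred) (hT : Typed I) (hS : SimpleOverlap I) {r₀ : ℕ} (hB : BoundaryExpanding r₀ I)
  {B : BridgeData n m} {e g₀ : Fin m} {u : Fin n} {κ₀ : ZMod 2} (hD : GateDataX I r₀ B e g₀ u κ₀) {mv : V2} (hmvT : mv = (0, 1) ∨ mv = (1, 1))
  (hP : ∀ e' ∈ B.N, e' ≠ e → ∀ a, ((sys I B).ρ e' a = 0 ∨ (sys I B).ρ e' a = mv) ∧ ((sys I B).ρ' e' a = 0 ∨ (sys I B).ρ' e' a = mv))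
  (hread : ∀ e' ∈ B.N, e' ≠ e → ∀ a, (sys I B).ρ e' a ≠ 0 ∨ (sys I B).ρ' e' a ≠ 0)
  {π : Fin m} (hπD : π ∈ B.D e) (hπ2 : I.vars π 2 ≠ u) (hπ3 : I.vars π 3 ≠ u)
  (hpriv : ∀ j' ∈ insert g₀ B.J₀, j' ≠ π → I.vars π 2 ∉ varSet I j' ∧ I.vars π 3 ∉ varSet I j')
include hI hT hS hB hD hmvT hP hread hπD hπ2 hπ3 hpriv

omit hpriv in
/-- `π` lies on every fundamental set. -/
theorem private_mem_all {c : Fin m} (hc : c ∈ B.N) : π ∈ B.D c := by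
  classical
  by_cases hce : c = e
  · exact hce ▸ hπD
  by_contra hπc
  rcases (caseT_through I hI hT hS hB hD hmvT hP hread hc hce).1 π (Finset.mem_symmDiff.2 (Or.inl ⟨hπD, hπc⟩)) with h | h
  · exact hπ2 h
  · exact hπ3 h

/-- **Flipping `x_α` raises every prescribed product by `x_{α'}`.** -/
theorem u_flip_fst {c : Fin m} (hc : c ∈ B.N) (y : Fin n → ZMod 2) :
    (sys I B).u c (y + Pi.single (I.vars π 2) 1) = (sys I B).u c y + y (I.vars π 3) := by
  classical
  obtain ⟨-, hW, -⟩ := id hD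
  have hπc := private_mem_all I hI hT hS hB hD hmvT hP hread hπD hπ2 hπ3 hc
  have hDcJ : B.D c ⊆ B.J₀ := fun k hk => (mem_sdiff.1 (hW.hD c hc hk)).1
  have hprivD : ∀ j ∈ B.D c, j ≠ π → I.vars π 2 ∉ andPair I j := fun j hj hne h =>
    (hpriv j (mem_insert_of_mem (hDcJ hj)) hne).1 (andPair_subset_varSet I j h)
  rw [u_add I B c, PstarPathRank.polar_symm_and I (B.D c), polar_single_of_private I hI (B.D c) hπc (Or.inl ⟨rfl, rfl⟩) hprivD,
    sys_u_eq I B c (Pi.single _ _), qform_single_and I hI, sys_u_eq I B c 0]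
  have h0 : qform (B.D c) (fun j => I.vars j 2) (fun j => I.vars j 3) (0 : Fin n → ZMod 2) = 0 := by simp [qform]
  rw [h0, add_zero]
  generalize (sys I B).u c y = a; generalize gam B c = g; generalize y (I.vars π 3) = t; revert a g t; decide

/-- **Flipping `x_{α'}` raises every prescribed product by `x_α`.** -/
theorem u_flip_snd {c : Fin m} (hc : c ∈ B.N) (y : Fin n → ZMod 2) :
    (sys I B).u c (y + Pi.single (I.vars π 3) 1) = (sys I B).u c y + y (I.vars π 2) := by
  classical
  obtain ⟨-, hW, -⟩ := id hD
  have hπc := private_mem_all I hI hT hS hB hD hmvT hP hread hπD hπ2 hπ3 hc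
  have hDcJ : B.D c ⊆ B.J₀ := fun k hk => (mem_sdiff.1 (hW.hD c hc hk)).1
  have hprivD : ∀ j ∈ B.D c, j ≠ π → I.vars π 3 ∉ andPair I j := fun j hj hne h =>
    (hpriv j (mem_insert_of_mem (hDcJ hj)) hne).2 (andPair_subset_varSet I j h)
  rw [u_add I B c, PstarPathRank.polar_symm_and I (B.D c), polar_single_of_private I hI (B.D c) hπc (Or.inr ⟨rfl, rfl⟩) hprivD,
    sys_u_eq I B c (Pi.single _ _), qform_single_and I hI, sys_u_eq I B c 0]
  have h0 : qform (B.D c) (fun j => I.vars j 2) (fun j => I.vars j 3) (0 : Fin n → ZMod 2) = 0 := by simp [qform]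
  rw [h0, add_zero]
  generalize (sys I B).u c y = a; generalize gam B c = g; generalize y (I.vars π 2) = t; revert a g t; decide

omit hT hS hB hmvT hP hread hπD hπ2 hπ3 hpriv in
/-- **A flip off `u` moves the value by the state-free part only** (all reads are constant or through `x_u`). -/
theorem val_flip (x w : Fin n → ZMod 2) (hwu : w u = 0) (s : Fin m → ZMod 2 × ZMod 2) :
    (sys I B).val B.N (x + w) s = (sys I B).val B.N x s + ((sys I B).F (x + w) + (sys I B).F x) := by
  classical
  obtain ⟨-, hW, -, -, -, -, -, -, hG, -, -, -, -, -, -, hcoef, -⟩ := id hD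
  have hρ : ∀ c ∈ B.N, (sys I B).ρ c (x + w) = (sys I B).ρ c x ∧ (sys I B).ρ' c (x + w) = (sys I B).ρ' c x := by
    intro c hc
    by_cases hce : c = e
    · subst hce
      refine ⟨?_, by rw [(gate_reads I hI hG (x + w)).2, (gate_reads I hI hG x).2]⟩
      rw [(gate_reads I hI hG (x + w)).1, (gate_reads I hI hG x).1, hcoef, hcoef, Pi.add_apply, hwu, add_zero]
    · exact const_of_others I hW hG c hc hce (x + w) x
  unfold ChordSystem.val
  have hc : ∑ c ∈ B.N, (sys I B).contrib (x + w) s c = ∑ c ∈ B.N, (sys I B).contrib x s c := by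
    refine sum_congr rfl fun c hc' => ?_
    unfold ChordSystem.contrib
    rw [(hρ c hc').1, (hρ c hc').2]
  rw [hc]
  generalize (sys I B).F (x + w) = a; generalize (sys I B).F x = b; generalize ∑ c ∈ B.N, (sys I B).contrib x s c = c
  have h2 : b + b = 0 := Prod.ext (CharTwo.add_self_eq_zero b.1) (CharTwo.add_self_eq_zero b.2)
  calc a + c = a + c + (b + b) := by rw [h2, add_zero]
    _ = b + c + (a + b) := by abel

/-- **The touch lemma.**  See the module docstring. -/
theorem caseT_private_touch :
    ¬ ∀ y : Fin n → ZMod 2,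
      qDir I B mv (y + Pi.single (I.vars π 2) 1) = qDir I B mv y +
          polarDir I B mv (Pi.single (I.vars π 2) 1) (Pi.single (I.vars π 3) 1) * y (I.vars π 3) ∧
      qDir I B mv (y + Pi.single (I.vars π 3) 1) = qDir I B mv y +
          polarDir I B mv (Pi.single (I.vars π 2) 1) (Pi.single (I.vars π 3) 1) * y (I.vars π 2) ∧
      qDir I B (1, 0) (y + Pi.single (I.vars π 2) 1) = qDir I B (1, 0) y +
          polarDir I B (1, 0) (Pi.single (I.vars π 2) 1) (Pi.single (I.vars π 3) 1) * y (I.vars π 3) ∧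
      qDir I B (1, 0) (y + Pi.single (I.vars π 3) 1) = qDir I B (1, 0) y +
          polarDir I B (1, 0) (Pi.single (I.vars π 2) 1) (Pi.single (I.vars π 3) 1) * y (I.vars π 2) := by
  classical
  intro hno
  have hUα := fun {c : Fin m} (hc : c ∈ B.N) => u_flip_fst I hI hT hS hB hD hmvT hP hread hπD hπ2 hπ3 hpriv hc
  have hUα' := fun {c : Fin m} (hc : c ∈ B.N) => u_flip_snd I hI hT hS hB hD hmvT hP hread hπD hπ2 hπ3 hpriv hc
  have hπall := fun {c : Fin m} (hc : c ∈ B.N) => private_mem_all I hI hT hS hB hD hmvT hP hread hπD hπ2 hπ3 hc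
  have hVF := val_flip I hI hD (e := e)
  obtain ⟨hXc, hW, hr, hd₁, hd₂, hL, -, -, hG, hg₀, hgv, -, hup, hux, hG₁p, hcoef, hT3, hM0⟩ := id hD
  have he : e ∈ B.N := hG.1
  have hπJ : π ∈ B.J₀ := (mem_sdiff.1 (hW.hD e he hπD)).1
  have hinf : (sys I B).Infeasible B.N := infeasible_of_not_solution I hI hT hW hL hT3
  -- the defect values `τ₁ = [π ∈ T₁]`, `τ₂ = [π ∈ T₂]` and the two second differences
  set τ₁ : ZMod 2 := if π ∈ B.T₁ then 1 else 0 with hτ₁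
  set τ₂ : ZMod 2 := if π ∈ B.T₂ then 1 else 0 with hτ₂
  have hmv2 : mv.2 = 1 := by rcases hmvT with h | h <;> rw [h]
  have hpol : polarDir I B mv (Pi.single (I.vars π 2) 1) (Pi.single (I.vars π 3) 1) = τ₁ + mv.1 * τ₂ := by
    rw [polarDir_single_pair I hI hS hd₁ hd₂ mv hπJ, hmv2, one_mul]
  have hpol2 : polarDir I B (1, 0) (Pi.single (I.vars π 2) 1) (Pi.single (I.vars π 3) 1) = τ₂ := by
    rw [polarDir_single_pair I hI hS hd₁ hd₂ (1, 0) hπJ]; simp [hτ₂]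
  -- (M0) at `π`, defect form
  obtain ⟨z, hz⟩ := hM0 π hπJ
  have hpp' : I.vars e 2 ≠ I.vars e 3 := fun h => absurd (hI.2 e h) (by decide)
  have hp'priv : I.vars e 3 ∈ privs I B.N := vars_mem_privs I he (s := 3) (by decide)
  obtain ⟨hunG₁, hunG₂⟩ := hG.2.1 _ hp'priv (Ne.symm hpp')
  have hG₁'' : ∀ g ∈ B.G₁.erase g₀, I.vars g 2 ≠ I.vars e 2 ∧ I.vars g 2 ≠ I.vars e 3 ∧ I.vars g 3 ≠ I.vars e 2 ∧ I.vars g 3 ≠ I.vars e 3 :=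
    fun g hg => ⟨(hG₁p g hg).1, (hunG₁ g (mem_of_mem_erase hg)).1, (hG₁p g hg).2, (hunG₁ g (mem_of_mem_erase hg)).2⟩
  have hG₂'' : ∀ g ∈ B.G₂, I.vars g 2 ≠ I.vars e 2 ∧ I.vars g 2 ≠ I.vars e 3 ∧ I.vars g 3 ≠ I.vars e 2 ∧ I.vars g 3 ≠ I.vars e 3 :=
    fun g hg => ⟨(hG.2.2.1 g hg).1, (hunG₂ g hg).1, (hG.2.2.1 g hg).2, (hunG₂ g hg).2⟩
  obtain ⟨hchord, hval⟩ := gate_forest_minimality I hI hT hW he hπD hg₀ hgv hup hG₁'' hG₂'' hz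
  have hδ := defect_eq_one I hI hW he hπD hT3 hz
  set x : Fin n → ZMod 2 := fun v => bit (z v) with hxdef
  set st : Fin m → ZMod 2 × ZMod 2 := fun c => (bit (z (I.vars c 2)), bit (z (I.vars c 3))) with hst
  rw [hδ] at hval
  -- every chord's state product is `u_c(x) + 1`
  have hprod : ∀ c ∈ B.N, (st c).1 * (st c).2 = (sys I B).u c x + 1 := by
    intro c hc
    show bit (z (I.vars c 2)) * bit (z (I.vars c 3)) = _
    by_cases hce : c = e
    · rw [hce]
      have e2 : ∀ U s : ZMod 2, U + s = 1 → s = U + 1 := by decide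
      exact e2 _ _ hδ
    · have h := hchord c hc hce
      rw [if_pos (hπall hc), hδ] at h
      exact h
  -- the contradiction at a flipped point with all products raised by one and the state-free part moved by `(τ₁, τ₂)`
  have key : ∀ w : Fin n → ZMod 2, w u = 0 → (∀ c ∈ B.N, (sys I B).u c (x + w) = (sys I B).u c x + 1) →
      qDir I B mv (x + w) = qDir I B mv x + (τ₁ + mv.1 * τ₂) → qDir I B (1, 0) (x + w) = qDir I B (1, 0) x + τ₂ → False := by
    intro w hwu hU hq hq2
    refine hinf (x + w) st (fun c hc => by rw [hprod c hc, hU c hc]) ?_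
    rw [hVF x w hwu st, hval]
    have hF : (sys I B).F (x + w) + (sys I B).F x = (τ₁, τ₂) := by
      unfold PstarChordBridgeBasis.qDir at hq hq2
      simp only [hmv2, one_mul, zero_mul, zero_add] at hq hq2
      have e2 : ∀ a b t c : ZMod 2, a + c = b + c + t → a = b + t := by decide
      have hF2 := e2 _ _ _ _ hq2
      rw [hF2] at hq
      have e8 : ∀ a a' b f c k t s : ZMod 2, a' + b + k * (f + s + c) = a + b + k * (f + c) + (t + k * s) → a' + a = t := by decide
      have hF1 := e8 _ _ _ _ _ _ _ _ hq
      rw [sys_F, sys_F, hF2]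
      ext
      · simp only [Prod.fst_add]; exact hF1
      · simp only [Prod.snd_add]
        generalize free I B.y (B.J₀ \ B.N) B.N B.T₂ B.C₂ B.G₂ x = f; revert f; generalize τ₂ = s; revert s; decide
    rw [hF]
    have hz2 : ((τ₁, τ₂) : V2) + (τ₁, τ₂) = 0 := Prod.ext (CharTwo.add_self_eq_zero τ₁) (CharTwo.add_self_eq_zero τ₂)
    rw [add_assoc, hz2, add_zero]
  set ea : Fin n → ZMod 2 := Pi.single (I.vars π 2) 1 with hea
  set ea' : Fin n → ZMod 2 := Pi.single (I.vars π 3) 1 with hea'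
  have hau : ea u = 0 := by rw [hea, Pi.single_eq_of_ne (Ne.symm hπ2)]
  have ha'u : ea' u = 0 := by rw [hea', Pi.single_eq_of_ne (Ne.symm hπ3)]
  have h23 : I.vars π 2 ≠ I.vars π 3 := fun h => absurd (hI.2 π h) (by decide)
  have z01 : ∀ t : ZMod 2, t = 0 ∨ t = 1 := by decide
  rcases z01 (x (I.vars π 3)) with hα'0 | hα'1
  · rcases z01 (x (I.vars π 2)) with hα0 | hα1
    · -- both `0`: flip both
      refine key (ea + ea') (by rw [Pi.add_apply, hau, ha'u, add_zero]) (fun c hc => ?_) ?_ ?_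
      · rw [← add_assoc, hUα' hc, hUα hc, Pi.add_apply, hα'0, hα0, hea, Pi.single_eq_same]; ring
      · rw [← add_assoc, (hno (x + ea)).2.1, (hno x).1, hpol, Pi.add_apply, hα'0, hα0, hea, Pi.single_eq_same]; ring
      · rw [← add_assoc, (hno (x + ea)).2.2.2, (hno x).2.2.1, hpol2, Pi.add_apply, hα'0, hα0, hea, Pi.single_eq_same]; ring
    · -- `x_α = 1`: flip `α'`
      refine key ea' ha'u (fun c hc => by rw [hUα' hc, hα1]) ?_ ?_
      · rw [(hno x).2.1, hpol, hα1, mul_one]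
      · rw [(hno x).2.2.2, hpol2, hα1, mul_one]
  · -- `x_{α'} = 1`: flip `α`
    refine key ea hau (fun c hc => by rw [hUα hc, hα'1]) ?_ ?_
    · rw [(hno x).1, hpol, hα'1, mul_one]
    · rw [(hno x).2.2.1, hpol2, hα'1, mul_one]

end CaseT

end Summit.PneNP.PneNP.Theorems.PstarGateCaseTPrivateTouch
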